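import Mathlib
import Literature.NumberTheory.Sieve.SingularSeries
import Summits.Parity.GeneralizedHardyLittlewood.Theses.LiouvilleShiftedTables

/-!
# `PairsFromMAvg`, part 3: `∑_n b_h(n)/n = 𝔖({0,h})` (Euler product of the pair singular series)

Route `LiouvilleShiftedTables` (Parity / GeneralizedHardyLittlewood), support item stmt-Parity-14275
(`PairsFromMAvg`). For the multiplicative weight `b = b_h` of part 2 (`b(p^k) = 1` if `p ∣ h`,
`-1/(p-1)` if `p ∤ h`), the absolutely convergent series `∑_n b(n)/n` has the Euler product
`∏_p (1 + b(p)/(p-1))`, whose factors `p/(p-1)` (`p ∣ h`) and `1 - 1/(p-1)²` (`p ∤ h`) are exactly the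
Hardy–Littlewood factors `(1 - ν_{{0,h}}(p)/p)(1 - 1/p)⁻²` of the tree's ordered product
`Literature.NumberTheory.Sieve.singularSeries {0, h}` (`hasProd_singularSeriesFactor_holds`). This is
the identity `-∑_{(d,h)=1} μ(d) log d/φ(d) = 𝔖({0,h})` in Euler-product form
(Goldston–Yıldırım, Lemma 2.1, main term at `j = 1`).

* `tupleResidueCount_pair_zero` — `ν_{{0,h}}(p) = 1` if `p ∣ h`, `= 2` otherwise (`p` prime);
* `singularSeriesFactor_pair_zero` — the factor at `p` equals `1 + b(p) p⁻¹ (1 - p⁻¹)⁻¹`;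
* `tsum_weight_div_eq_singularSeries` — `∑' n, b(n)/n = singularSeries {0, h}`.

[folklore; cite: GoldstonYildirim2001, Lemma 2.1 (2.9)]
-/

noncomputable section

open Finset Real ArithmeticFunction Filter
open scoped ArithmeticFunction.Moebius

namespace Summit.Parity.GeneralizedHardyLittlewood.Theorems.PairsFromMAvg

open Literature.NumberTheory.Sieve (tupleResidueCount singularSeriesFactor singularSeries
  hasProd_singularSeriesFactor_holds)

/-- `ν_{{0,h}}(p)`: the pair `{0, h}` occupies one class mod `p` if `p ∣ h`, two otherwise (any
modulus `p`). [folklore] -/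
theorem tupleResidueCount_pair_zero (h p : ℕ) :
    tupleResidueCount ({0, (h : ℤ)} : Finset ℤ) p = if p ∣ h then 1 else 2 := by
  classical
  unfold tupleResidueCount
  rw [Finset.image_insert, Finset.image_singleton, Int.cast_zero, Int.cast_natCast]
  have hiff : ((h : ℕ) : ZMod p) = 0 ↔ p ∣ h := by
    rw [← Int.cast_natCast, ZMod.intCast_zmod_eq_zero_iff_dvd, Int.natCast_dvd_natCast]
  by_cases hdvd : p ∣ h
  · rw [if_pos hdvd, hiff.mpr hdvd, Finset.insert_eq_of_mem (Finset.mem_singleton_self _),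
      Finset.card_singleton]
  · rw [if_neg hdvd, Finset.card_pair (fun h0 => hdvd (hiff.mp h0.symm))]

/-- The Hardy–Littlewood factor of `{0, h}` at a prime `p` (`h ≠ 0`):
`p/(p-1) = (1 - 1/p)⁻¹` if `p ∣ h` and `1 - 1/(p-1)²` if `p ∤ h`, written uniformly as
`1 + β_p · p⁻¹(1 - p⁻¹)⁻¹` with `β_p = 1` resp. `-1/(p-1)`. [folklore] -/
theorem singularSeriesFactor_pair_zero {h : ℕ} (hh : h ≠ 0) {p : ℕ} (hp : p.Prime) :
    singularSeriesFactor ({0, (h : ℤ)} : Finset ℤ) p =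
      1 + (if p ∣ h then 1 else -1 / ((p : ℝ) - 1)) * ((p : ℝ)⁻¹ * (1 - (p : ℝ)⁻¹)⁻¹) := by
  classical
  have hp2 : (2 : ℝ) ≤ p := by exact_mod_cast hp.two_le
  have hp0 : (p : ℝ) ≠ 0 := by positivity
  have hp1 : (p : ℝ) - 1 ≠ 0 := by linarith
  have hcard : ({0, (h : ℤ)} : Finset ℤ).card = 2 :=
    Finset.card_pair (by exact_mod_cast (Nat.pos_of_ne_zero hh).ne)
  unfold singularSeriesFactor
  rw [hcard, tupleResidueCount_pair_zero h p]
  have e1 : (1 - (p : ℝ)⁻¹) = ((p : ℝ) - 1) / p := by field_simp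
  by_cases hdvd : p ∣ h
  · rw [if_pos hdvd, if_pos hdvd, e1]
    push_cast
    field_simp
    ring
  · rw [if_neg hdvd, if_neg hdvd, e1]
    push_cast
    field_simp
    ring

/-- **`∑_n b(n)/n = 𝔖({0,h})`.** For a multiplicative `b` with `b(p^k) = 1` (`p ∣ h`), `-1/(p-1)`
(`p ∤ h`) and `∑ |b(n)|/n < ∞`, the Euler product of `∑ b(n)/n` (Mathlib's
`EulerProduct.eulerProduct_hasProd`) has the factors of `𝔖({0,h})`
(`hasProd_singularSeriesFactor_holds`), so the two agree. [folklore] -/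
theorem tsum_weight_div_eq_singularSeries {h : ℕ} (hh : h ≠ 0) (b : ArithmeticFunction ℝ)
    (hb : b.IsMultiplicative)
    (hbp : ∀ p k : ℕ, p.Prime → 1 ≤ k → b (p ^ k) = if p ∣ h then 1 else -1 / ((p : ℝ) - 1))
    (hsum : Summable fun n : ℕ => ‖b n / n‖) :
    ∑' n : ℕ, b n / n = singularSeries ({0, (h : ℤ)} : Finset ℤ) := by
  set f : ℕ → ℝ := fun n => b n / n with hf
  have hf1 : f 1 = 1 := by simp [hf, hb.map_one]
  have hfmul : ∀ {m n : ℕ}, Nat.Coprime m n → f (m * n) = f m * f n := by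
    intro m n hmn
    simp only [hf]
    rw [hb.map_mul_of_coprime hmn, Nat.cast_mul, mul_div_mul_comm]
  have hf0 : f 0 = 0 := by simp [hf]
  have hE := EulerProduct.eulerProduct_hasProd hf1 hfmul hsum hf0
  have hS := hasProd_singularSeriesFactor_holds ({0, (h : ℤ)} : Finset ℤ)
  -- the local factors agree
  have hloc : ∀ p : Nat.Primes, ∑' e : ℕ, f (p ^ e) = singularSeriesFactor ({0, (h : ℤ)} : Finset ℤ) p := by
    intro p
    have hp := p.2
    have hp2 : (2 : ℝ) ≤ (p : ℕ) := by exact_mod_cast hp.two_le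
    set r : ℝ := ((p : ℕ) : ℝ)⁻¹ with hr
    have hr0 : 0 ≤ r := by positivity
    have hr1 : r < 1 := by
      rw [hr]; exact inv_lt_one_of_one_lt₀ (by linarith)
    set β : ℝ := (if (p : ℕ) ∣ h then 1 else -1 / (((p : ℕ) : ℝ) - 1)) with hβ
    have hfe : ∀ e : ℕ, f ((p : ℕ) ^ (e + 1)) = β * r * r ^ e := by
      intro e
      simp only [hf]
      rw [hbp p (e + 1) hp (by omega), Nat.cast_pow, hβ, hr, div_eq_mul_inv, ← inv_pow, pow_succ]
      ring
    have hsumf : Summable fun e : ℕ => f ((p : ℕ) ^ e) := by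
      rw [← summable_nat_add_iff 1]
      simp only [hfe]
      exact (summable_geometric_of_lt_one hr0 hr1).mul_left _
    rw [hsumf.tsum_eq_zero_add, pow_zero, hf1]
    simp only [hfe]
    rw [tsum_mul_left, tsum_geometric_of_lt_one hr0 hr1,
      singularSeriesFactor_pair_zero hh hp, hβ, hr, mul_assoc]
  have hE' : HasProd (fun p : Nat.Primes => singularSeriesFactor ({0, (h : ℤ)} : Finset ℤ) p)
      (∑' n : ℕ, f n) := by
    rw [show (fun p : Nat.Primes => singularSeriesFactor ({0, (h : ℤ)} : Finset ℤ) p) =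
      fun p : Nat.Primes => ∑' e : ℕ, f (p ^ e) from funext fun p => (hloc p).symm]
    exact hE
  exact hE'.unique hS

end Summit.Parity.GeneralizedHardyLittlewood.Theorems.PairsFromMAvg
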